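import Summits.AtomisticToContinuum.Crystallization.Theses.LaminarSixThreeThree

/-!
# Birth skeleton (BC3) for crux `LjLaminarity` — stmt-AtomisticToContinuum-14293

Route `LaminarSixThreeThree`, sub-problem `Crystallization`; registrar
`planner-skel-stmt-AtomisticToContinuum-14293-0` (2026-08-17).  Published as
`Cruxes/LjLaminarity/Lines/birth.lean`.

The crux (rank 2, "the bet"): for every thickness `t > 0` and radius `R > 0`, along every sequence of
Lennard-Jones ground states in `ℝ³` the fraction of particles whose `R`-window is NOT `t`-laminar
(no unit normal `n` and levels `c : ℤ → ℝ` with consecutive gaps `≥ 3/4` such that every particle within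
`R` lies within `t` of a level plane through the centre's frame) tends to `0`.

## The line: PRICED LAMINARITY, cut by scale

Write `bad(R,t)(y)` for the number of particles of a finite configuration `y` whose `R`-window is not
`t`-laminar (the crux's predicate, verbatim) and `e⋆ = ⨅_Q e_LJ(Q)` for the periodic infimum of the
energy per particle (`N·e⋆ ≤ 𝓔(y)` for every injective `y` and `E(N)/N → e⋆` are PROVED in tree:
`ChargedEnergyGapNegative.card_mul_eStar_le`, `ChargedEnergyGapNegative.crysEnergyLimit` = item 0626).

* `stub_firstShellLayeringPrice` — FRUSTRATION IS PRICED AT THE FIRST-SHELL SCALE (load-bearing, open):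
  for every `t₀ > 0` there is `γ > 0` with `N·e⋆ + γ·bad(3/2,t₀)(y) ≤ 𝓔_LJ(y)` for EVERY finite injective
  configuration `y`.  A global (summed, not sitewise) priced gap in the shape of the open crux
  `PricedLinkCensus.ChargedEnergyGap`, with "charge" = a first coordination shell (radius `3/2`: the twelve
  neighbours and the six in-adjacent-layer second neighbours of a Barlow site, nothing two layers away)
  that is not within `t₀` of three parallel planes with gaps `≥ 3/4`.  Icosahedral / polytetrahedral /
  Frank–Kasper shells and amorphous order are charged; Barlow, twinned and stacking-faulted sites, bcc
  (110)-layered sites and free-surface sites of a crystal are not.  This is where the barriers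
  `TetrahedralFrustration`, `IcosahedralClusters`, `LocalizedPotentialsExcludeLennardJones` live: the
  sitewise form is refuted (negatives item 17253, `DecahedralSoftShell`), the summed form with a positive
  tolerance `t₀` is not (cf. `ChargedEnergyGap.Negative.Tolerance`: tolerance `≤ 0` is refuted by trial
  states, tolerance `> 0` is open).
* `stub_coherencePrice` — MESOSCALE INCOHERENCE IS PAID BY ENERGY OR BY FIRST-SHELL DEFECTS (open, a
  geometric-rigidity statement): for all `t, R > 0` there are `t₀, γ > 0` and `C ≥ 0` with
  `γ·bad(R,t)(y) ≤ (𝓔_LJ(y) − N·e⋆) + C·bad(3/2,t₀)(y)` for every finite injective `y`.  Mechanism: a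
  window that is locally layered everywhere but not laminar carries a rotation of the layer normal of size
  `≥ t/R` across radius `R`; in a solid this is either elastic bending (curvature `≥ t/R²`, caught by the
  first-shell test once `t₀ ≲ t/R²`) or geometrically necessary dislocations of density `≥ t/(b R²)`
  (Nye / Read–Shockley; Lauteri–Luckhaus arXiv:1608.06155, Garroni–Leoni–Ponsiglione), whose cores are
  first-shell defects and whose energy is positive per unit length; wedge regions where two non-parallel
  coherent twins approach are `O(R²·N^{1/3})` and are paid by the excess `𝓔 − N e⋆ > 0` of any finite
  cluster.  Grain boundaries of bounded grains are unions of such tubes.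
* `laminarity_of_prices` (arrow form: hypotheses = the two stub statements, conclusion = the crux
  statement verbatim) and `LjLaminarity_of` (the crux BY NAME from the declared stubs) — the composition,
  sorry-free outside the stubs: along ground states `𝓔(x_N) = E(N)`, so the two prices give
  `bad(R,t)(x_N) ≤ K·(E(N) − N e⋆)` with `K = (1 + C/γ_A)/γ_B`; dividing by `N` and using the PROVED
  thermodynamic limit `E(N)/N → e⋆` (item 0626) squeezes the bad fraction to `0`.  No trial-state rate
  `E(N) ≤ N e⋆ + O(N^{2/3})` (which would lean on the open attainment item 0627) is needed.

Disproof used: none on file for this crux (`ledger crux ls` empty at registration).  Negatives checked: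
item 17253 (sitewise one-multiplier pricing, refuted) — both stubs are summed prices with a positive
thickness tolerance fixed BEFORE the price constant, not sitewise; item 4146 / `DecahedralSoftShell`
concern twelve-shell pattern inference, not used.
-/

namespace Summit.AtomisticToContinuum.Crystallization.Cruxes.LjLaminarity.Birth

open Literature.MathematicalPhysics.StatisticalMechanics
open Filter Topology

/-- **stub A — first-shell layering is priced.**  For every thickness `t₀ > 0` there is a price
`γ > 0` such that every finite injective configuration `y` of `ℝ³` satisfies
`N·e⋆ + γ·#{i : the 3/2-window of i is not t₀-laminar} ≤ 𝓔_LJ(y)`. -/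
theorem stub_firstShellLayeringPrice :
    ∀ t₀ : ℝ, 0 < t₀ → ∃ γ : ℝ, 0 < γ ∧
      ∀ (N : ℕ) (y : Fin N → EuclideanSpace ℝ (Fin 3)), Function.Injective y →
        (N : ℝ) * (⨅ Q : PeriodicConfiguration 3, Q.energyPerParticle lennardJones)
          + γ * (Nat.card {i : Fin N // ¬ (∃ n : EuclideanSpace ℝ (Fin 3), ‖n‖ = 1 ∧ ∃ c : ℤ → ℝ,
              (∀ k : ℤ, c k + 3 / 4 ≤ c (k + 1)) ∧ ∀ j : Fin N, dist (y j) (y i) ≤ 3 / 2 →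
                ∃ k : ℤ, |inner ℝ (y j - y i) n - c k| ≤ t₀)} : ℝ)
          ≤ interactionEnergy lennardJones y := by
  sorry

/-- **stub B — coherence price.**  For all `t, R > 0` there are a first-shell thickness `t₀ > 0`, a
price `γ > 0` and `C ≥ 0` such that every finite injective configuration `y` of `ℝ³` satisfies
`γ·#{i : the R-window of i is not t-laminar} ≤ (𝓔_LJ(y) − N·e⋆) + C·#{i : the 3/2-window of i is not
t₀-laminar}`. -/
theorem stub_coherencePrice :
    ∀ t R : ℝ, 0 < t → 0 < R → ∃ t₀ γ C : ℝ, 0 < t₀ ∧ 0 < γ ∧ 0 ≤ C ∧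
      ∀ (N : ℕ) (y : Fin N → EuclideanSpace ℝ (Fin 3)), Function.Injective y →
        γ * (Nat.card {i : Fin N // ¬ (∃ n : EuclideanSpace ℝ (Fin 3), ‖n‖ = 1 ∧ ∃ c : ℤ → ℝ,
              (∀ k : ℤ, c k + 3 / 4 ≤ c (k + 1)) ∧ ∀ j : Fin N, dist (y j) (y i) ≤ R →
                ∃ k : ℤ, |inner ℝ (y j - y i) n - c k| ≤ t)} : ℝ)
          ≤ (interactionEnergy lennardJones y
              - (N : ℝ) * (⨅ Q : PeriodicConfiguration 3, Q.energyPerParticle lennardJones))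
            + C * (Nat.card {i : Fin N // ¬ (∃ n : EuclideanSpace ℝ (Fin 3), ‖n‖ = 1 ∧ ∃ c : ℤ → ℝ,
              (∀ k : ℤ, c k + 3 / 4 ≤ c (k + 1)) ∧ ∀ j : Fin N, dist (y j) (y i) ≤ 3 / 2 →
                ∃ k : ℤ, |inner ℝ (y j - y i) n - c k| ≤ t₀)} : ℝ) := by
  sorry

/-- The bookkeeping inequality behind the composition: two prices give a linear bound of the bad
count by the excess energy. [folklore] -/
theorem bad_le_of_prices {γ γ' C S L X : ℝ} (hγ : 0 < γ) (hγ' : 0 < γ') (hC : 0 ≤ C)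
    (h1 : γ * S ≤ X + C * L) (h2 : γ' * L ≤ X) :
    S ≤ ((1 + C / γ') / γ) * X := by
  have h3 : L ≤ X / γ' := by
    rw [le_div_iff₀ hγ']
    linarith [h2]
  have h4 : C * L ≤ C * (X / γ') := mul_le_mul_of_nonneg_left h3 hC
  have h5 : γ * S ≤ X + C * (X / γ') := by linarith
  have h6 : X + C * (X / γ') = γ * (((1 + C / γ') / γ) * X) := by
    field_simp
  exact le_of_mul_le_mul_left (h5.trans h6.le) hγ

/-- **Composition, arrow form** (sorry-free): the two prices (as hypotheses) and the proved
thermodynamic limit `E(N)/N → e⋆` (item 0626) give the statement of the crux `LjLaminarity`, verbatim. -/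
theorem laminarity_of_prices
    (hA : ∀ t₀ : ℝ, 0 < t₀ → ∃ γ : ℝ, 0 < γ ∧
      ∀ (N : ℕ) (y : Fin N → EuclideanSpace ℝ (Fin 3)), Function.Injective y →
        (N : ℝ) * (⨅ Q : PeriodicConfiguration 3, Q.energyPerParticle lennardJones)
          + γ * (Nat.card {i : Fin N // ¬ (∃ n : EuclideanSpace ℝ (Fin 3), ‖n‖ = 1 ∧ ∃ c : ℤ → ℝ,
              (∀ k : ℤ, c k + 3 / 4 ≤ c (k + 1)) ∧ ∀ j : Fin N, dist (y j) (y i) ≤ 3 / 2 →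
                ∃ k : ℤ, |inner ℝ (y j - y i) n - c k| ≤ t₀)} : ℝ)
          ≤ interactionEnergy lennardJones y)
    (hB : ∀ t R : ℝ, 0 < t → 0 < R → ∃ t₀ γ C : ℝ, 0 < t₀ ∧ 0 < γ ∧ 0 ≤ C ∧
      ∀ (N : ℕ) (y : Fin N → EuclideanSpace ℝ (Fin 3)), Function.Injective y →
        γ * (Nat.card {i : Fin N // ¬ (∃ n : EuclideanSpace ℝ (Fin 3), ‖n‖ = 1 ∧ ∃ c : ℤ → ℝ,
              (∀ k : ℤ, c k + 3 / 4 ≤ c (k + 1)) ∧ ∀ j : Fin N, dist (y j) (y i) ≤ R →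
                ∃ k : ℤ, |inner ℝ (y j - y i) n - c k| ≤ t)} : ℝ)
          ≤ (interactionEnergy lennardJones y
              - (N : ℝ) * (⨅ Q : PeriodicConfiguration 3, Q.energyPerParticle lennardJones))
            + C * (Nat.card {i : Fin N // ¬ (∃ n : EuclideanSpace ℝ (Fin 3), ‖n‖ = 1 ∧ ∃ c : ℤ → ℝ,
              (∀ k : ℤ, c k + 3 / 4 ≤ c (k + 1)) ∧ ∀ j : Fin N, dist (y j) (y i) ≤ 3 / 2 →
                ∃ k : ℤ, |inner ℝ (y j - y i) n - c k| ≤ t₀)} : ℝ)) :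
    ∀ t R : ℝ, 0 < t → 0 < R → ∀ x : (N : ℕ) → (Fin N → EuclideanSpace ℝ (Fin 3)),
      (∀ N, IsGroundState lennardJones (x N)) →
        Tendsto (fun N : ℕ => (Nat.card {i : Fin N // ¬ (∃ n : EuclideanSpace ℝ (Fin 3), ‖n‖ = 1 ∧
          ∃ c : ℤ → ℝ, (∀ k : ℤ, c k + 3 / 4 ≤ c (k + 1)) ∧ ∀ j : Fin N, dist (x N j) (x N i) ≤ R →
            ∃ k : ℤ, |inner ℝ (x N j - x N i) n - c k| ≤ t)} : ℝ) / N) atTop (𝓝 0) := by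
  intro t R ht hR x hx
  obtain ⟨t₀, γ, C, ht₀, hγ, hC, hBx⟩ := hB t R ht hR
  obtain ⟨γ', hγ', hAx⟩ := hA t₀ ht₀
  -- the periodic infimum `e⋆` and the proved thermodynamic limit `E(N)/N → e⋆` (item 0626)
  set e : ℝ := ⨅ Q : PeriodicConfiguration 3, Q.energyPerParticle lennardJones with he
  have hlim : Tendsto (fun N : ℕ => groundStateEnergy lennardJones 3 N / N) atTop (𝓝 e) :=
    Summit.AtomisticToContinuum.Crystallization.Theorems.ChargedEnergyGapNegative.crysEnergyLimit
  set K : ℝ := (1 + C / γ') / γ with hK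
  have hlim0 : Tendsto (fun N : ℕ => K * (groundStateEnergy lennardJones 3 N / N - e)) atTop (𝓝 0) := by
    have h := (hlim.sub_const e).const_mul K
    simpa using h
  refine squeeze_zero' (Eventually.of_forall fun N => by positivity) ?_ hlim0
  refine eventually_atTop.2 ⟨1, fun N hN => ?_⟩
  have hNpos : (0 : ℝ) < N := by exact_mod_cast hN
  have hNne : (N : ℝ) ≠ 0 := ne_of_gt hNpos
  have hinj : Function.Injective (x N) := (hx N).1
  have hE : interactionEnergy lennardJones (x N) = groundStateEnergy lennardJones 3 N := (hx N).2
  have h1 := hBx N (x N) hinj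
  have h2 := hAx N (x N) hinj
  rw [hE] at h1 h2
  -- linear bound of the bad count by the excess energy `E(N) − N e⋆`
  have hbound := bad_le_of_prices (S := (Nat.card {i : Fin N // ¬ (∃ n : EuclideanSpace ℝ (Fin 3),
      ‖n‖ = 1 ∧ ∃ c : ℤ → ℝ, (∀ k : ℤ, c k + 3 / 4 ≤ c (k + 1)) ∧ ∀ j : Fin N,
        dist (x N j) (x N i) ≤ R → ∃ k : ℤ, |inner ℝ (x N j - x N i) n - c k| ≤ t)} : ℝ))
    (X := groundStateEnergy lennardJones 3 N - (N : ℝ) * e)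
    hγ hγ' hC h1 (by linarith [h2])
  have hdiv : (groundStateEnergy lennardJones 3 N - (N : ℝ) * e) / N
      = groundStateEnergy lennardJones 3 N / N - e := by
    rw [sub_div, mul_div_cancel_left₀ e hNne]
  calc (Nat.card {i : Fin N // ¬ (∃ n : EuclideanSpace ℝ (Fin 3), ‖n‖ = 1 ∧ ∃ c : ℤ → ℝ,
          (∀ k : ℤ, c k + 3 / 4 ≤ c (k + 1)) ∧ ∀ j : Fin N, dist (x N j) (x N i) ≤ R →
            ∃ k : ℤ, |inner ℝ (x N j - x N i) n - c k| ≤ t)} : ℝ) / N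
        ≤ (K * (groundStateEnergy lennardJones 3 N - (N : ℝ) * e)) / N :=
          div_le_div_of_nonneg_right hbound hNpos.le
    _ = K * (groundStateEnergy lennardJones 3 N / N - e) := by
          rw [mul_div_assoc, hdiv]

/-- **Composition** `LjLaminarity_of`: the crux BY NAME from the two declared stubs (kernel-checked;
its only `sorry`s are the ones inside `stub_firstShellLayeringPrice` and `stub_coherencePrice`). -/
theorem LjLaminarity_of :
    Summit.AtomisticToContinuum.Crystallization.Theses.LaminarSixThreeThree.LjLaminarity :=
  laminarity_of_prices stub_firstShellLayeringPrice stub_coherencePrice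

end Summit.AtomisticToContinuum.Crystallization.Cruxes.LjLaminarity.Birth
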